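import Summits.Schanuel.Schanuel.Theorems.RootDecomp1KCommonRadixCell01

/-!
# RootDecomp1KCommonRadixCell — lens 1, generation 37 «COMMON-RADIX WALL CELL of 33364» (the dependent-base wall `(1, ℓ₂, ℓ₄)`) — continuation (RootDecomp1KCommonRadixCell02): §4 (CR-dom) the common-radix non-vanishing theorem `eventually_eval_partialSum_ne_zero_commonRadix` — all-order dominance via the universal polynomial

(lens-1 g37 `RootDecomp1KCommonRadixCell.lean`, sha256 2ee3a3e8…2418, own farm rc 0 · 0 sorry · axioms std; critic VERDICT STATUS L1748
(credit K-R23 (β′), PORT GO LOW); port by census-1 gen 16 in seven parts `RootDecomp1KCommonRadixCell01`–`07` — see the PORT NOTE of part 01;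
`--supports stmt-Schanuel-33364`; rung 0.)
-/

noncomputable section

open Complex IntermediateField Polynomial
open Summit.Schanuel.Schanuel.Theorems.RootDecomp1KHyper
open Summit.Schanuel.Schanuel.Theorems.RootDecomp1KHyper.HyperCell
open Summit.Schanuel.Schanuel.Theorems.RootDecomp1KGeneric
open Summit.Schanuel.Schanuel.Theorems.RootDecomp1KRelLiouvilleCell
open Summit.Schanuel.Schanuel.Theorems.RootDecomp1KLogLogCell (LogLogLiouville logLogLiouville_of_logSqLiouville
  logLogLiouville_of_logHyperLiouville logLogLiouville_of_hyperLiouville)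
open Summit.Schanuel.Schanuel.Theorems.RootDecomp1KTwoBaseCell (partialSum_pos' liouvilleNumber_le partialSum_lt_two numerator_lt exists_int_mul_eq_map' algebraicIndependent_of_forall_int' norm_pow_sub_pow_le' norm_prod_pow_sub_prod_pow_le norm_aeval_sub_aeval_le growth_beats lpart
  tpart lpart_apply tpart_apply eq_of_parts_eq psNumer partialSum_eq_psNumer_div coprime_psNumer liouvilleNumber_sub_rat_lower_loglog not_logLogLiouville_liouvilleNumber liouvilleNumber_three_lt_one sb_of_range_eq')

namespace Summit.Schanuel.Schanuel.Theorems.RootDecomp1KCommonRadixCell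

open LiouvilleNumber
open scoped Nat

/-- Upper bound for the tail in base `m ≥ 2`: `r_k ≤ 2·m^{-(k+1)!}` (g36, verbatim). -/
private theorem remainder_le {m : ℝ} (hm : 2 ≤ m) (k : ℕ) : remainder m k ≤ 2 / m ^ (k + 1)! := by
  have m1 : (1 : ℝ) < m := by linarith
  have m0 : (0 : ℝ) < m := by linarith
  have h := remainder_lt' k m1
  have hhalf : (1 : ℝ) / m ≤ 1 / 2 := one_div_le_one_div_of_le two_pos hm
  have hpos : (0 : ℝ) < 1 - 1 / m := by linarith
  have hinv : (1 - 1 / m)⁻¹ ≤ 2 := by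
    rw [inv_le_comm₀ hpos two_pos]
    linarith
  have hmk : (0 : ℝ) < 1 / m ^ (k + 1)! := by positivity
  calc remainder m k ≤ (1 - 1 / m)⁻¹ * (1 / m ^ (k + 1)!) := h.le
    _ ≤ 2 * (1 / m ^ (k + 1)!) := mul_le_mul_of_nonneg_right hinv hmk.le
    _ = 2 / m ^ (k + 1)! := by ring

/-! ## §4  THE COMMON-RADIX NON-VANISHING THEOREM — all-order dominance via the universal polynomial -/

section CommonRadix
open LiouvilleNumber
open scoped Nat

variable {k : ℕ}

/-- `|x^n − y^n| ≤ n δ` on `[-1, 1]`. -/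
theorem abs_pow_sub_pow_le {x y δ : ℝ} (hx : |x| ≤ 1) (hy : |y| ≤ 1) (hxy : |x - y| ≤ δ) (n : ℕ) :
    |x ^ n - y ^ n| ≤ n * δ := by
  have hδ : 0 ≤ δ := (abs_nonneg _).trans hxy
  induction n with
  | zero => simp
  | succ n ih =>
    have e : x ^ (n + 1) - y ^ (n + 1) = x * (x ^ n - y ^ n) + (x - y) * y ^ n := by ring
    rw [e]
    have h1 : |x * (x ^ n - y ^ n)| ≤ 1 * (n * δ) := by
      rw [abs_mul]; exact mul_le_mul hx ih (abs_nonneg _) zero_le_one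
    have h2 : |(x - y) * y ^ n| ≤ δ * 1 := by
      rw [abs_mul, abs_pow]; exact mul_le_mul hxy (pow_le_one₀ (abs_nonneg _) hy) (by positivity) hδ
    calc |x * (x ^ n - y ^ n) + (x - y) * y ^ n| ≤ 1 * (n * δ) + δ * 1 := (abs_add_le _ _).trans (add_le_add h1 h2)
      _ = ((n + 1 : ℕ) : ℝ) * δ := by push_cast; ring

/-- `|∏ xᵢ^{eᵢ} − ∏ yᵢ^{eᵢ}| ≤ (Σ eᵢ) δ` on `[-1, 1]^s` (telescoping). -/
theorem abs_prod_pow_sub_prod_pow_le (s : Finset (Fin k)) {x y : Fin k → ℝ} (e : Fin k → ℕ) {δ : ℝ}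
    (hδ : 0 ≤ δ) (hx : ∀ i, |x i| ≤ 1) (hy : ∀ i, |y i| ≤ 1) (hxy : ∀ i, |x i - y i| ≤ δ) :
    |∏ i ∈ s, x i ^ e i - ∏ i ∈ s, y i ^ e i| ≤ (∑ i ∈ s, e i : ℕ) * δ := by
  classical
  induction s using Finset.induction_on with
  | empty => simp
  | insert a s ha ih =>
    rw [Finset.prod_insert ha, Finset.prod_insert ha, Finset.sum_insert ha]
    set u := x a ^ e a
    set u' := y a ^ e a
    set v := ∏ i ∈ s, x i ^ e i
    set v' := ∏ i ∈ s, y i ^ e i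
    set E' := ∑ i ∈ s, e i
    have eq1 : u * v - u' * v' = u * (v - v') + (u - u') * v' := by ring
    have hu : |u| ≤ 1 := by rw [abs_pow]; exact pow_le_one₀ (abs_nonneg _) (hx a)
    have hv' : |v'| ≤ 1 := by
      rw [Finset.abs_prod]
      refine Finset.prod_le_one (fun i _ => abs_nonneg _) fun i _ => ?_
      rw [abs_pow]; exact pow_le_one₀ (abs_nonneg _) (hy i)
    have huu' : |u - u'| ≤ e a * δ := abs_pow_sub_pow_le (hx a) (hy a) (hxy a) (e a)
    rw [eq1]
    calc |u * (v - v') + (u - u') * v'| ≤ |u| * |v - v'| + |u - u'| * |v'| := by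
          refine (abs_add_le _ _).trans (add_le_add ?_ ?_) <;> rw [abs_mul]
      _ ≤ 1 * ((E' : ℝ) * δ) + (e a * δ) * 1 :=
          add_le_add (mul_le_mul hu ih (abs_nonneg _) zero_le_one)
            (mul_le_mul huu' hv' (abs_nonneg _) (by positivity))
      _ = ((e a + E' : ℕ) : ℝ) * δ := by push_cast; ring

/-- The Lipschitz constant of a real polynomial on the unit cube: `Σ_m |c_m| · |m|`. -/
def lipConst (p : MvPolynomial (Fin k) ℝ) : ℝ := ∑ m ∈ p.support, |p.coeff m| * ((∑ i, m i : ℕ) : ℝ)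

/-- The Lipschitz constant is non-negative. -/
theorem lipConst_nonneg (p : MvPolynomial (Fin k) ℝ) : 0 ≤ lipConst p :=
  Finset.sum_nonneg fun _ _ => by positivity

/-- **Lipschitz bound on the unit cube:** `|p(x) − p(y)| ≤ lipConst p · δ`. -/
theorem abs_eval_sub_eval_le (p : MvPolynomial (Fin k) ℝ) {x y : Fin k → ℝ} {δ : ℝ} (hδ : 0 ≤ δ)
    (hx : ∀ i, |x i| ≤ 1) (hy : ∀ i, |y i| ≤ 1) (hxy : ∀ i, |x i - y i| ≤ δ) :
    |MvPolynomial.eval x p - MvPolynomial.eval y p| ≤ lipConst p * δ := by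
  classical
  rw [MvPolynomial.eval_eq', MvPolynomial.eval_eq', ← Finset.sum_sub_distrib, lipConst, Finset.sum_mul]
  refine (Finset.abs_sum_le_sum_abs _ _).trans (Finset.sum_le_sum fun m _ => ?_)
  rw [← mul_sub, abs_mul, mul_assoc]
  refine mul_le_mul_of_nonneg_left ?_ (abs_nonneg _)
  exact abs_prod_pow_sub_prod_pow_le _ m hδ hx hy hxy

/-- Entries of exponents in the support are bounded by the total degree. -/
theorem le_totalDegree_of_mem_support {p : MvPolynomial (Fin k) ℝ} {m : Fin k →₀ ℕ} (hm : m ∈ p.support)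
    (j : Fin k) : m j ≤ p.totalDegree := by
  have h1 := MvPolynomial.le_totalDegree hm
  rw [Finsupp.sum_fintype _ _ (fun _ => rfl)] at h1
  exact le_trans (Finset.single_le_sum (f := fun i => m i) (fun _ _ => Nat.zero_le _) (Finset.mem_univ j)) h1

/-- **THE COMMON-RADIX NON-VANISHING THEOREM (CR).**  `β ≥ 2`, `a : Fin k → ℕ` injective with `a_i ≥ 1`,
bases `b_i = β^{a_i}` (multiplicatively DEPENDENT; the weights `∏ b_i^{m_i} = β^{Σ a_i m_i}` collide).  Then every
non-zero real polynomial `q(Y_1, …, Y_k)` is non-zero at the simultaneous truncations `s_N = (partialSum b_i N)_i` for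
all large `N`.  PROOF (all-order dominance): `q(s_N) = p(r_N)` with `p(W) = q(ℓ − W) ≠ 0` and the tails
`r_{N,i} = Σ_{j<k} T_j^{a_i} + ρ_i`, `T_j = β^{-(N+1+j)!} = u^{E_j}` (`u = β^{-(N+1)!}`), `0 < ρ_i ≤ 2u^{E_k}`; the
universal polynomial `H = p(Φ(T))`, `Φ_i = Σ_j T_j^{a_i}`, is NON-ZERO by §3 (Jacobian); under `T_j = u^{E_j}` its
monomials get the PAIRWISE DISTINCT exponents `κ(m) = Σ m_j E_j` (§2, digits `≤ deg H ≤ N+1`), so the minimal one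
dominates with an integer gap: `|q(s_N)| ≥ u^{κ*}(c_min − (Σ|c_m| + 2·lipConst p)·u) > 0`.  THE TWO LARGENESS
CONDITIONS ON `N`, explicitly (the proof's threshold is `N₀ = max (totalDegree H) ⌈(Σ_m |c_m| + 2·lipConst p)/c_min⌉₊`):
(i) `N ≥ totalDegree H` — then every digit `m_j ≤ deg H ≤ N + 1 < N + 2` is admissible for the mixed radix
`E_j = (N+2)(N+3)⋯(N+1+j)` (so `m ↦ κ(m)` is injective on `supp H`, `kappa_injective`) and every `κ(m) < E_k`
(`kappa_lt_E`), which puts the tail error `ρ_i ≤ 2u^{E_k} ≤ 2u^{κ*+1}` above the minimal exponent; (ii) `N + 1 > A`,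
`A = (Σ|c_m| + 2·lipConst p)/c_min` — then `u ≤ β^{-(N+1)} < 1/(N+1) < 1/A`, i.e. `u·(Σ|c_m| + 2·lipConst p) < c_min`. -/
theorem eventually_eval_partialSum_ne_zero_commonRadix {β : ℕ} (hβ : 2 ≤ β) {a : Fin k → ℕ}
    (ha : Function.Injective a) (ha1 : ∀ i, 1 ≤ a i) {q : MvPolynomial (Fin k) ℝ} (hq : q ≠ 0) :
    ∃ N₀ : ℕ, ∀ N, N₀ ≤ N →
      MvPolynomial.eval (fun i => partialSum (((fun i => β ^ a i) i : ℕ) : ℝ) N) q ≠ 0 := by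
  classical
  -- (a) bases
  have hβ1 : (1 : ℝ) ≤ β := by exact_mod_cast (by omega : 1 ≤ β)
  have hβR : (2 : ℝ) ≤ β := by exact_mod_cast hβ
  have hβ0 : (0 : ℝ) < β := by linarith
  have hbR : ∀ i, (((fun i => β ^ a i) i : ℕ) : ℝ) = (β : ℝ) ^ a i := fun i => by push_cast; rfl
  simp only [hbR]
  have hb2 : ∀ i, (2 : ℝ) ≤ (β : ℝ) ^ a i := fun i =>
    hβR.trans (le_self_pow₀ hβ1 (by have := ha1 i; omega))
  have hb1 : ∀ i, (1 : ℝ) < (β : ℝ) ^ a i := fun i => by linarith [hb2 i]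
  set ℓ : Fin k → ℝ := fun i => liouvilleNumber ((β : ℝ) ^ a i) with hℓ
  -- (b) the Taylor shift `p(W) = q(ℓ − W)`
  set p : MvPolynomial (Fin k) ℝ :=
    MvPolynomial.bind₁ (fun i => MvPolynomial.C (ℓ i) - MvPolynomial.X i) q with hp
  have aeval_eq : ∀ (v : Fin k → ℝ) (f : MvPolynomial (Fin k) ℝ),
      MvPolynomial.aeval v f = MvPolynomial.eval v f := fun v f => rfl
  have hpq : ∀ w : Fin k → ℝ, MvPolynomial.eval w p = MvPolynomial.eval (fun i => ℓ i - w i) q := by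
    intro w
    rw [← aeval_eq, ← aeval_eq, hp, MvPolynomial.aeval_bind₁]
    have e : (fun i => MvPolynomial.aeval w
        (MvPolynomial.C (ℓ i) - (MvPolynomial.X i : MvPolynomial (Fin k) ℝ))) = fun i => ℓ i - w i := by
      funext i; simp
    rw [e]
  have hp0 : p ≠ 0 := by
    intro h0
    have hback : MvPolynomial.aeval (fun i => MvPolynomial.C (ℓ i) - MvPolynomial.X i) p = q := by
      rw [hp, MvPolynomial.aeval_bind₁]
      have : (fun i => MvPolynomial.aeval
          (fun i => MvPolynomial.C (ℓ i) - (MvPolynomial.X i : MvPolynomial (Fin k) ℝ))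
          (MvPolynomial.C (ℓ i) - MvPolynomial.X i)) =
          (MvPolynomial.X : Fin k → MvPolynomial (Fin k) ℝ) := by
        funext i; simp
      rw [this, MvPolynomial.aeval_X_left_apply]
    rw [h0, map_zero] at hback
    exact hq hback.symm
  -- (c) the universal polynomial `H = p ∘ Φ`
  set H : MvPolynomial (Fin k) ℝ := MvPolynomial.bind₁ (powerSum a) p with hH
  have hH0 : H ≠ 0 := bind₁_powerSum_ne_zero ha ha1 hp0
  have hHeval : ∀ T : Fin k → ℝ,
      MvPolynomial.eval T H = MvPolynomial.eval (fun i => ∑ j, T j ^ a i) p := by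
    intro T
    rw [← aeval_eq, ← aeval_eq, hH, MvPolynomial.aeval_bind₁]
    have e : (fun i => MvPolynomial.aeval T (powerSum a i)) = fun i => ∑ j, T j ^ a i := by
      funext i; rw [aeval_eq, eval_powerSum]
    rw [e]
  have hS : H.support.Nonempty := MvPolynomial.support_nonempty.mpr hH0
  set D : ℕ := H.totalDegree with hDdef
  have hdig : ∀ m ∈ H.support, ∀ j, m j ≤ D := fun m hm j => le_totalDegree_of_mem_support hm j
  -- (d) constants
  obtain ⟨mc, hmcS, hmc⟩ := Finset.exists_min_image H.support (fun m => |H.coeff m|) hS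
  set cmin : ℝ := |H.coeff mc| with hcmin
  have hcmin0 : 0 < cmin := abs_pos.mpr (MvPolynomial.mem_support_iff.mp hmcS)
  have hcmin_le : ∀ m ∈ H.support, cmin ≤ |H.coeff m| := fun m hm => hmc m hm
  set cS : ℝ := ∑ m ∈ H.support, |H.coeff m| with hcS
  have hcS0 : 0 ≤ cS := Finset.sum_nonneg fun _ _ => abs_nonneg _
  set K : ℝ := lipConst p with hK
  have hK0 : 0 ≤ K := lipConst_nonneg p
  set A : ℝ := (cS + 2 * K) / cmin with hA
  have hA0 : 0 ≤ A := by positivity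
  -- (e) the threshold
  refine ⟨max D ⌈A⌉₊, fun N hN => ?_⟩
  have hND : D ≤ N := le_trans (le_max_left _ _) hN
  have hNA : A < (N : ℝ) + 1 := by
    have h1 : A ≤ ⌈A⌉₊ := Nat.le_ceil _
    have h2 : (⌈A⌉₊ : ℝ) ≤ N := by exact_mod_cast le_trans (le_max_right _ _) hN
    linarith
  -- (f) the scale `u = β^{-(N+1)!}` and `T_j = u^{E_j}`
  set M : ℕ := (N + 1)! with hM
  have hM1 : N + 1 ≤ M := Nat.self_le_factorial _
  set u : ℝ := 1 / (β : ℝ) ^ M with hu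
  have hu0 : 0 < u := by positivity
  have hβM : (N : ℝ) + 1 < (β : ℝ) ^ M := by
    have h1 : ((N + 1 : ℕ) : ℝ) < (2 : ℝ) ^ (N + 1) := by exact_mod_cast Nat.lt_two_pow_self
    have h2 : (2 : ℝ) ^ (N + 1) ≤ (2 : ℝ) ^ M := pow_le_pow_right₀ (by norm_num) hM1
    have h3 : (2 : ℝ) ^ M ≤ (β : ℝ) ^ M := pow_le_pow_left₀ (by norm_num) hβR M
    push_cast at h1; linarith
  have hu1 : u ≤ 1 := by
    rw [hu, div_le_one (by positivity)]; linarith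
  have huA : u * (cS + 2 * K) < cmin := by
    -- `u < 1/(N+1) ≤ 1/A`-type bookkeeping: `A < N+1 < β^M = 1/u`
    have h1 : A * u < 1 := by
      rw [hu, ← mul_div_assoc, mul_one, div_lt_one (by positivity)]; linarith
    have h2 : A * u * cmin = u * (cS + 2 * K) := by rw [hA]; field_simp
    nlinarith
  set T : Fin k → ℝ := fun j => u ^ E N j with hT
  have hT0 : ∀ j, 0 < T j := fun j => pow_pos hu0 _
  have hTle : ∀ j, T j ≤ u := fun j => pow_le_of_le_one hu0.le hu1 (E_pos N j).ne'
  have hT1 : ∀ j, T j ≤ 1 := fun j => (hTle j).trans hu1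
  have hTβ : ∀ j, T j = 1 / (β : ℝ) ^ (N + 1 + j)! := fun j => by
    rw [hT]; simp only
    rw [hu, one_div_pow, ← pow_mul, hM, factorial_mul_E]
  -- (g) tails: `r_i = Σ_j T_j^{a_i} + ρ_i`, `0 < ρ_i ≤ 2 u^{E_k}`
  set r : Fin k → ℝ := fun i => remainder ((β : ℝ) ^ a i) N with hr
  set ρ : Fin k → ℝ := fun i => remainder ((β : ℝ) ^ a i) (N + k) with hρ
  have hρ0 : ∀ i, 0 < ρ i := fun i => remainder_pos (hb1 i) _
  have hsplit : ∀ i, r i = (∑ j, T j ^ a i) + ρ i := by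
    intro i
    rw [hr]; simp only
    rw [remainder_split (hb1 i) N k, ← Fin.sum_univ_eq_sum_range]
    congr 1
    refine Finset.sum_congr rfl fun j _ => ?_
    rw [hTβ, one_div_pow, ← pow_mul, ← pow_mul, mul_comm]
  have hρle : ∀ i, ρ i ≤ 2 * u ^ E N k := by
    intro i
    have h1 : ρ i ≤ 2 / ((β : ℝ) ^ a i) ^ (N + k + 1)! := remainder_le (hb2 i) (N + k)
    have h2 : (β : ℝ) ^ (N + k + 1)! ≤ ((β : ℝ) ^ a i) ^ (N + k + 1)! :=
      pow_le_pow_left₀ hβ0.le (le_self_pow₀ hβ1 (by have := ha1 i; omega)) _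
    have h3 : u ^ E N k = 1 / (β : ℝ) ^ (N + k + 1)! := by
      have e : N + k + 1 = N + 1 + k := by omega
      rw [hu, one_div_pow, ← pow_mul, hM, factorial_mul_E, e]
    rw [h3, ← div_eq_mul_one_div]
    exact h1.trans (div_le_div_of_nonneg_left (by norm_num) (by positivity) h2)
  have hr1 : ∀ i, r i ≤ 1 := by
    intro i
    have h1 : r i ≤ 2 / ((β : ℝ) ^ a i) ^ (N + 1)! := remainder_le (hb2 i) N
    have h2 : (2 : ℝ) ≤ ((β : ℝ) ^ a i) ^ (N + 1)! :=
      (hb2 i).trans (le_self_pow₀ (by linarith [hb2 i]) (Nat.factorial_pos _).ne')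
    have h3 : 2 / ((β : ℝ) ^ a i) ^ (N + 1)! ≤ 1 := by rw [div_le_one (by positivity)]; exact h2
    exact h1.trans h3
  have hr0 : ∀ i, 0 < r i := fun i => remainder_pos (hb1 i) _
  -- (h) `q(s_N) = p(r_N)`
  have hs : (fun i => partialSum ((β : ℝ) ^ a i) N) = fun i => ℓ i - r i := by
    funext i
    have := partialSum_add_remainder (hb1 i) N
    simp only [hr, hℓ]; linarith
  have hqs : MvPolynomial.eval (fun i => partialSum ((β : ℝ) ^ a i) N) q = MvPolynomial.eval r p := by
    rw [hpq, hs]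
  rw [hqs]
  -- (i) the main term `p(ΦT) = H(T) = Σ c_m u^{κ m}`
  set y : Fin k → ℝ := fun i => ∑ j, T j ^ a i with hy
  have hry : ∀ i, r i = y i + ρ i := hsplit
  have hmain_eq : MvPolynomial.eval y p = ∑ m ∈ H.support, H.coeff m * u ^ kappa N m := by
    rw [← hHeval, MvPolynomial.eval_eq']
    refine Finset.sum_congr rfl fun m _ => ?_
    congr 1
    rw [kappa, ← Finset.prod_pow_eq_pow_sum]
    refine Finset.prod_congr rfl fun j _ => ?_
    rw [hT]; simp only
    rw [← pow_mul, mul_comm]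
  -- (j) the minimal exponent and the gap
  obtain ⟨m₀, hm₀S, hmin⟩ := Finset.exists_min_image H.support (kappa N) hS
  have hdigN : ∀ m ∈ H.support, ∀ j, m j ≤ N + 1 := fun m hm j => (hdig m hm j).trans (by omega)
  have hgap : ∀ m ∈ H.support, m ≠ m₀ → kappa N m₀ + 1 ≤ kappa N m := by
    intro m hm hne
    have h1 : kappa N m₀ ≤ kappa N m := hmin m hm
    have h2 : kappa N m ≠ kappa N m₀ := fun h =>
      hne (kappa_injective N (hdigN m hm) (hdigN m₀ hm₀S) h)
    omega
  have hκE : kappa N m₀ + 1 ≤ E N k := kappa_lt_E N (hdigN m₀ hm₀S)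
  set κ₀ : ℕ := kappa N m₀ with hκ₀
  have huκ : ∀ m ∈ H.support, m ≠ m₀ → u ^ kappa N m ≤ u ^ (κ₀ + 1) := fun m hm hne =>
    pow_le_pow_of_le_one hu0.le hu1 (hgap m hm hne)
  have huE : u ^ E N k ≤ u ^ (κ₀ + 1) := pow_le_pow_of_le_one hu0.le hu1 hκE
  -- (k) lower bound for the main term
  have hmain : cmin * u ^ κ₀ - cS * u ^ (κ₀ + 1) ≤ |MvPolynomial.eval y p| := by
    rw [hmain_eq, ← Finset.add_sum_erase _ _ hm₀S]
    have h1 : cmin * u ^ κ₀ ≤ |H.coeff m₀ * u ^ kappa N m₀| := by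
      rw [abs_mul, abs_of_pos (pow_pos hu0 _)]
      exact mul_le_mul_of_nonneg_right (hcmin_le m₀ hm₀S) (pow_pos hu0 _).le
    have h2 : |∑ m ∈ H.support.erase m₀, H.coeff m * u ^ kappa N m| ≤ cS * u ^ (κ₀ + 1) := by
      refine (Finset.abs_sum_le_sum_abs _ _).trans ?_
      have h3 : ∑ m ∈ H.support.erase m₀, |H.coeff m * u ^ kappa N m| ≤
          ∑ m ∈ H.support.erase m₀, |H.coeff m| * u ^ (κ₀ + 1) := by
        refine Finset.sum_le_sum fun m hm => ?_
        rw [abs_mul, abs_of_pos (pow_pos hu0 _)]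
        exact mul_le_mul_of_nonneg_left
          (huκ m (Finset.mem_of_mem_erase hm) (Finset.ne_of_mem_erase hm)) (abs_nonneg _)
      refine h3.trans ?_
      rw [← Finset.sum_mul]
      refine mul_le_mul_of_nonneg_right ?_ (pow_pos hu0 _).le
      rw [hcS]
      exact Finset.sum_le_sum_of_subset_of_nonneg (Finset.erase_subset _ _) fun _ _ _ => abs_nonneg _
    -- `|a + b| ≥ |a| − |b|`
    have h5 : |H.coeff m₀ * u ^ kappa N m₀| - |∑ m ∈ H.support.erase m₀, H.coeff m * u ^ kappa N m| ≤
        |H.coeff m₀ * u ^ kappa N m₀ + ∑ m ∈ H.support.erase m₀, H.coeff m * u ^ kappa N m| :=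
      abs_sub_abs_le_abs_add _ _
    linarith
  -- (l) the truncation error `|p(r) − p(y)| ≤ K · 2u^{E_k} ≤ 2K u^{κ₀+1}`
  have herr : |MvPolynomial.eval r p - MvPolynomial.eval y p| ≤ 2 * K * u ^ (κ₀ + 1) := by
    have hx' : ∀ i, |r i| ≤ 1 := fun i => by rw [abs_of_pos (hr0 i)]; exact hr1 i
    have hy0 : ∀ i, 0 ≤ y i := fun i => Finset.sum_nonneg fun j _ => pow_nonneg (hT0 j).le _
    have hy' : ∀ i, |y i| ≤ 1 := fun i => by
      rw [abs_of_nonneg (hy0 i)]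
      have := hry i; linarith [hρ0 i, hr1 i]
    have hxy : ∀ i, |r i - y i| ≤ 2 * u ^ E N k := fun i => by
      rw [hry i, add_sub_cancel_left, abs_of_pos (hρ0 i)]; exact hρle i
    have h1 := abs_eval_sub_eval_le p (by positivity) hx' hy' hxy
    calc |MvPolynomial.eval r p - MvPolynomial.eval y p| ≤ K * (2 * u ^ E N k) := h1
      _ ≤ K * (2 * u ^ (κ₀ + 1)) := by gcongr
      _ = 2 * K * u ^ (κ₀ + 1) := by ring
  -- (m) conclude
  intro hzero
  have h1 : |MvPolynomial.eval y p| ≤ 2 * K * u ^ (κ₀ + 1) := by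
    have : MvPolynomial.eval y p = -(MvPolynomial.eval r p - MvPolynomial.eval y p) := by rw [hzero]; ring
    rw [this, abs_neg]; exact herr
  have h2 : cmin * u ^ κ₀ ≤ (cS + 2 * K) * u ^ (κ₀ + 1) := by linarith
  have h3 : (cS + 2 * K) * u ^ (κ₀ + 1) = (u * (cS + 2 * K)) * u ^ κ₀ := by ring
  rw [h3] at h2
  have h4 := lt_of_le_of_lt h2 (mul_lt_mul_of_pos_right huA (pow_pos hu0 _))
  exact lt_irrefl _ h4

end CommonRadix

end Summit.Schanuel.Schanuel.Theorems.RootDecomp1KCommonRadixCell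

end
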